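import Summits.Ventures.GridStability.Bench.GroundedLaplacianPath300CertData
import HarnessLib

/-!
# GroundedLaplacianPath300Cert — T-L2b instance: the DECIDES (columns in range, symmetry, clique-sum sweep, block LDLᵀ) and the certified
connectivity constant for the data of `GroundedLaplacianPath300CertData.lean` (see its header for the graph, λ, sizes and heights). [folklore]
-/

namespace Summit.Ventures.GridStability.Bench.GroundedLaplacianPath300Cert

open Literature.Computation.Certificates Literature.Computation.Certificates.PSD
open Literature.MathematicalPhysics.PowerSystems Summit.Ventures.GridStability.Lyapunov

/-- Every stored column index is a node (`< 300`). [folklore] -/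
theorem cols : colsBelow 300 W = true := by decide +kernel

/-- The weights are symmetric: ONE sparse check against the radix transpose (`d = 9`). [folklore] -/
theorem symm : SMat.eqCheck 300 W (SMat.transpose 9 300 W) = true := by decide +kernel

/-- The clique-sum identity `L_g − λI = Σ_c P_cᵀ S_c P_c` for the rows COMPUTED by `groundedSMat` (ONE row-streamed decide). [folklore] -/
theorem sweep : cliqueSweepS 299 0 299 (groundedSMatIn 299 W 299 lam) blocks = true := by decide +kernel

/-- Every clique block is PSD (ONE decide, in-kernel exact `LDLᵀ` per block). [folklore] -/
theorem ldl : ldlAll blocks = true := by decide +kernel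

/-- **CERTIFIED CONNECTIVITY CONSTANT** `λ = 17/524288` for this graph: `∀ z, λ·‖Hz‖₂² ≤ 300·½ΣΣ wᵢⱼ(zᵢ − zⱼ)²` — the `hlam`
hypothesis of the dVOC Condition-2 / droop / Kuramoto chains, from the SPARSE grounded certificate. [folklore] -/
theorem connectivity_certificate :
    ∀ z : Fin 300 → ℝ, (lam : ℝ) * pairNormSq z
      ≤ ((299 + 1 : ℕ) : ℝ) * (1 / 2 * ∑ i, ∑ j, ((matrixOfSparseRows 300 300 W i j : ℚ) : ℝ) * (z i - z j) ^ 2) :=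
  connectivity_certificate_of_grounded_smatIn (d := 9) W (by norm_num) cols symm g lam (by norm_num [lam]) blocks sweep ldl

end Summit.Ventures.GridStability.Bench.GroundedLaplacianPath300Cert
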